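import Literature.AlgebraicGeometry.Motives.AbelianVarietyPointCountIsogenyInvariance
import Literature.AlgebraicGeometry.Motives.AbelianVarietyGaloisCharpolyIsogenyRelations
import Literature.AlgebraicGeometry.Motives.AbelianVarietyMordellWeilRankIsogenyRelations
import HarnessLib

/-!
# The Klein four-group relation `X × B_G² ∼ B_a × B_b × B_{ab}` read on point counts, `ℓ`-adic characteristic
# polynomials of Galois and Frobenius, traces, and Mordell–Weil ranks

For a Klein four-group `G = {1, a, b, ab}` acting on an abelian variety `X` over a perfect field through
`ρ : G → End X`, with `B_x := Im(1 + ρ(x)) = ε_⟨x⟩(X)` (`(1 + ρ x)² = 2(1 + ρ x)`) and `B_G := Im N_G`, the tree proves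
Paulhus' relation (3) / Kani–Rosen's Theorem B for `V₄ = ⟨a⟩ ∪ ⟨b⟩ ∪ ⟨ab⟩` halved by Poincaré reducibility,
`X × B_G² ∼ B_a × B_b × B_{ab}` (`Motives/AbelianVarietyIdempotentRelations` §9, `isIsogenous_kleinFour_halved`; for a
curve with `V₄ ≤ Aut`, "`J_X × J²_{X/⟨a,b⟩} ∼ J_{X/⟨a⟩} × J_{X/⟨b⟩} × J_{X/⟨ab⟩}`", Accola's
`g_X + 2 g_{X/G} = g_{X/⟨a⟩} + g_{X/⟨b⟩} + g_{X/⟨ab⟩}` — the quotient-curve reading is not asserted here).  This file reads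
it through the additive isogeny-invariant functors of the generation:

* over a finite field, for every `m ≥ 1`: **`N_m(X) · N_m(B_G)² = N_m(B_a) · N_m(B_b) · N_m(B_{ab})`** (the point-count
  identity behind "`#J_C(𝔽_q) · #J_{C/G}(𝔽_q)² = ∏_x #J_{C/⟨x⟩}(𝔽_q)`" for biquadratic / bielliptic configurations);
* for every `σ ∈ Gal(K̄/K)` and `ℓ` invertible in `K`:
  `charpoly(σ | T_ℓ X) · charpoly(σ | T_ℓ B_G)² = ∏_x charpoly(σ | T_ℓ B_x)`, the trace form
  `Tr(σ | T_ℓ X) + 2 Tr(σ | T_ℓ B_G) = Σ_x Tr(σ | T_ℓ B_x)`, and over a finite field Milne's `P_X · P_{B_G}² = P_a P_b P_{ab}`;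
* for the Mordell–Weil groups over any `L/K` (finite-rank hypotheses explicit):
  `rk X(L) + 2 rk B_G(L) = rk B_a(L) + rk B_b(L) + rk B_{ab}(L)`.

## Main statements (sorry-free; theorems only, no new definitions)

`pointCount_mul_pointCount_sq_kleinFour`, `charpoly_tateRep_mul_charpoly_sq_kleinFour`, `trace_tateRep_add_two_mul_kleinFour`,
`charpoly_frobenius_mul_charpoly_sq_kleinFour`, `finrank_points_add_two_mul_kleinFour`.

Scope (stated, not hidden).  `G` is any group with `IsKleinFour G` and `a, b` two distinct non-trivial elements; perfect
(resp. finite) base field; `ℓ ≠ char K`; `B_x = Im(1 + ρ x)`, `B_G = Im N_G`; no curves, no `L`-functions.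

## References

* [Paulhus2008] J. Paulhus, *Decomposing Jacobians of curves with extra automorphisms*, Acta Arith. 132 (2008), §3 (2), (3) (p. 234).
* [KaniRosen1989] E. Kani, M. Rosen, *Idempotent relations and factors of Jacobians*, Math. Ann. 284 (1989), Thm. B, Thm. C.
* [Tate1966Endomorphisms] J. Tate, *Endomorphisms of abelian varieties over finite fields* (1966), §1 Thm. 1.
* [Milne1986AbelianVarieties] J. S. Milne, *Abelian varieties* (1986), §19 Thm. 19.1 and its proof (pp. 143–145).
* [MumfordAV1970] D. Mumford, *Abelian Varieties* (1970), §19 (pp. 169, 176, 180).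
* [DokchitserEtAl2022] V. Dokchitser, H. Green, A. Konstantinou, A. Morgan, *Parity of ranks of Jacobians of curves* (2022),
  §1.3 Ex. 1.4 and §3.
-/

noncomputable section

open CategoryTheory CategoryTheory.Limits
open scoped TensorProduct
open Literature.NumberTheory.DiophantineGeometry

universe u

namespace Literature.AlgebraicGeometry.Motives

namespace AbelianVariety

variable {K : Type u} [Field K] {X : AbelianVariety K} {G : Type} [Group G] [Fintype G] [DecidableEq G] [IsKleinFour G]
  (ρ : G →* End X) {a b : G}

/-- **`N_m(X) · N_m(B_G)² = N_m(B_a) · N_m(B_b) · N_m(B_{ab})`** over a finite field, `m ≥ 1`, for a Klein four-group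
`{1, a, b, ab}` acting on `X` (`B_x = Im(1 + ρ x)`, `B_G = Im N_G`): `X × B_G² ∼ B_a × B_b × B_{ab}` counted.
[cite: Paulhus2008, §3 (3) (p. 234)] [cite: KaniRosen1989, Thm. B] [cite: Tate1966Endomorphisms, §1 Thm. 1]
[cite: Milne1986AbelianVarieties, §19, proof of Thm. 19.1 (p. 145)] -/
theorem pointCount_mul_pointCount_sq_kleinFour [Finite K] (ha : a ≠ 1) (hb : b ≠ 1) (hab : a ≠ b) {NG : X ⟶ X}
    (hNG : End.of NG = ∑ g, ρ g) {m : ℕ} (hm : 0 < m) :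
    pointCount X.X m * pointCount (image NG).X m ^ 2 =
      pointCount (image (𝟙 X + End.asHom (ρ a))).X m * pointCount (image (𝟙 X + End.asHom (ρ b))).X m *
        pointCount (image (𝟙 X + End.asHom (ρ (a * b)))).X m := by
  haveI : PerfectField K := PerfectField.ofFinite
  have h := (isIsogenous_kleinFour_halved ρ ha hb hab hNG).pointCount_eq hm
  simp only [pointCount_biprod _ _ hm] at h
  rw [sq, h, mul_assoc]

variable [PerfectField K] (ℓ : ℕ) [Fact ℓ.Prime]

/-- **`charpoly(σ | T_ℓ X) · charpoly(σ | T_ℓ B_G)² = charpoly(σ | T_ℓ B_a) · charpoly(σ | T_ℓ B_b) · charpoly(σ | T_ℓ B_{ab})`**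
in `ℤ_ℓ[X]`, for every `σ ∈ Gal(K̄/K)` (perfect field, `ℓ` invertible in `K`; the Tate-module instances are the tree's
theorems). [cite: Paulhus2008, §3 (3) (p. 234)] [cite: KaniRosen1989, Thm. B] [cite: Tate1966Endomorphisms, §1] [cite: MumfordAV1970, §19 p. 176] -/
theorem charpoly_tateRep_mul_charpoly_sq_kleinFour (ha : a ≠ 1) (hb : b ≠ 1) (hab : a ≠ b) {NG : X ⟶ X}
    (hNG : End.of NG = ∑ g, ρ g) (hℓ : (ℓ : K) ≠ 0) (σ : Field.absoluteGaloisGroup K) :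
    haveI := X.module_free_tateModule_holds ℓ hℓ
    haveI := module_finite_tateModule_of_cast_ne_zero X ℓ hℓ
    haveI := (image NG).module_free_tateModule_holds ℓ hℓ
    haveI := module_finite_tateModule_of_cast_ne_zero (image NG) ℓ hℓ
    haveI := (image (𝟙 X + End.asHom (ρ a))).module_free_tateModule_holds ℓ hℓ
    haveI := module_finite_tateModule_of_cast_ne_zero (image (𝟙 X + End.asHom (ρ a))) ℓ hℓ
    haveI := (image (𝟙 X + End.asHom (ρ b))).module_free_tateModule_holds ℓ hℓ
    haveI := module_finite_tateModule_of_cast_ne_zero (image (𝟙 X + End.asHom (ρ b))) ℓ hℓ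
    haveI := (image (𝟙 X + End.asHom (ρ (a * b)))).module_free_tateModule_holds ℓ hℓ
    haveI := module_finite_tateModule_of_cast_ne_zero (image (𝟙 X + End.asHom (ρ (a * b)))) ℓ hℓ
    (X.tateRep ℓ σ).charpoly * ((image NG).tateRep ℓ σ).charpoly ^ 2 =
      ((image (𝟙 X + End.asHom (ρ a))).tateRep ℓ σ).charpoly * ((image (𝟙 X + End.asHom (ρ b))).tateRep ℓ σ).charpoly *
        ((image (𝟙 X + End.asHom (ρ (a * b)))).tateRep ℓ σ).charpoly := by
  haveI := X.module_free_tateModule_holds ℓ hℓ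
  haveI := module_finite_tateModule_of_cast_ne_zero X ℓ hℓ
  haveI := (image NG).module_free_tateModule_holds ℓ hℓ
  haveI := module_finite_tateModule_of_cast_ne_zero (image NG) ℓ hℓ
  haveI := (image (𝟙 X + End.asHom (ρ a))).module_free_tateModule_holds ℓ hℓ
  haveI := module_finite_tateModule_of_cast_ne_zero (image (𝟙 X + End.asHom (ρ a))) ℓ hℓ
  haveI := (image (𝟙 X + End.asHom (ρ b))).module_free_tateModule_holds ℓ hℓ
  haveI := module_finite_tateModule_of_cast_ne_zero (image (𝟙 X + End.asHom (ρ b))) ℓ hℓ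
  haveI := (image (𝟙 X + End.asHom (ρ (a * b)))).module_free_tateModule_holds ℓ hℓ
  haveI := module_finite_tateModule_of_cast_ne_zero (image (𝟙 X + End.asHom (ρ (a * b)))) ℓ hℓ
  haveI := (image NG ⊞ image NG).module_free_tateModule_holds ℓ hℓ
  haveI := module_finite_tateModule_of_cast_ne_zero (image NG ⊞ image NG) ℓ hℓ
  haveI := (X ⊞ (image NG ⊞ image NG)).module_free_tateModule_holds ℓ hℓ
  haveI := module_finite_tateModule_of_cast_ne_zero (X ⊞ (image NG ⊞ image NG)) ℓ hℓ
  haveI := (image (𝟙 X + End.asHom (ρ b)) ⊞ image (𝟙 X + End.asHom (ρ (a * b)))).module_free_tateModule_holds ℓ hℓ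
  haveI := module_finite_tateModule_of_cast_ne_zero
    (image (𝟙 X + End.asHom (ρ b)) ⊞ image (𝟙 X + End.asHom (ρ (a * b)))) ℓ hℓ
  haveI := (image (𝟙 X + End.asHom (ρ a)) ⊞ (image (𝟙 X + End.asHom (ρ b)) ⊞
    image (𝟙 X + End.asHom (ρ (a * b))))).module_free_tateModule_holds ℓ hℓ
  haveI := module_finite_tateModule_of_cast_ne_zero (image (𝟙 X + End.asHom (ρ a)) ⊞
    (image (𝟙 X + End.asHom (ρ b)) ⊞ image (𝟙 X + End.asHom (ρ (a * b))))) ℓ hℓ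
  have h := (isIsogenous_kleinFour_halved ρ ha hb hab hNG).charpoly_tateRep_eq' hℓ σ
  rw [charpoly_tateRep_biprod_of_natCast_ne_zero ℓ _ _ hℓ σ, charpoly_tateRep_biprod_of_natCast_ne_zero ℓ _ _ hℓ σ,
    charpoly_tateRep_biprod_of_natCast_ne_zero ℓ _ _ hℓ σ, charpoly_tateRep_biprod_of_natCast_ne_zero ℓ _ _ hℓ σ] at h
  rw [sq, h, mul_assoc]

/-- **`Tr(σ | T_ℓ X) + 2 Tr(σ | T_ℓ B_G) = Tr(σ | T_ℓ B_a) + Tr(σ | T_ℓ B_b) + Tr(σ | T_ℓ B_{ab})`** for every `σ ∈ Gal(K̄/K)`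
(the virtual `ℓ`-adic representation `V_ℓ X + 2 V_ℓ B_G − Σ_x V_ℓ B_x` has character zero).
[cite: Paulhus2008, §3 (3) (p. 234)] [cite: KaniRosen1989, Thm. B] [cite: MumfordAV1970, §19 Thm. 4 (p. 180)] -/
theorem trace_tateRep_add_two_mul_kleinFour (ha : a ≠ 1) (hb : b ≠ 1) (hab : a ≠ b) {NG : X ⟶ X}
    (hNG : End.of NG = ∑ g, ρ g) (hℓ : (ℓ : K) ≠ 0) (σ : Field.absoluteGaloisGroup K) :
    LinearMap.trace ℤ_[ℓ] _ (X.tateRep ℓ σ) + 2 * LinearMap.trace ℤ_[ℓ] _ ((image NG).tateRep ℓ σ) =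
      LinearMap.trace ℤ_[ℓ] _ ((image (𝟙 X + End.asHom (ρ a))).tateRep ℓ σ) +
        LinearMap.trace ℤ_[ℓ] _ ((image (𝟙 X + End.asHom (ρ b))).tateRep ℓ σ) +
          LinearMap.trace ℤ_[ℓ] _ ((image (𝟙 X + End.asHom (ρ (a * b)))).tateRep ℓ σ) := by
  haveI := X.module_free_tateModule_holds ℓ hℓ
  haveI := module_finite_tateModule_of_cast_ne_zero X ℓ hℓ
  haveI := (image NG).module_free_tateModule_holds ℓ hℓ
  haveI := module_finite_tateModule_of_cast_ne_zero (image NG) ℓ hℓ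
  haveI := (image (𝟙 X + End.asHom (ρ a))).module_free_tateModule_holds ℓ hℓ
  haveI := module_finite_tateModule_of_cast_ne_zero (image (𝟙 X + End.asHom (ρ a))) ℓ hℓ
  haveI := (image (𝟙 X + End.asHom (ρ b))).module_free_tateModule_holds ℓ hℓ
  haveI := module_finite_tateModule_of_cast_ne_zero (image (𝟙 X + End.asHom (ρ b))) ℓ hℓ
  haveI := (image (𝟙 X + End.asHom (ρ (a * b)))).module_free_tateModule_holds ℓ hℓ
  haveI := module_finite_tateModule_of_cast_ne_zero (image (𝟙 X + End.asHom (ρ (a * b)))) ℓ hℓ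
  have h := congrArg Polynomial.nextCoeff (charpoly_tateRep_mul_charpoly_sq_kleinFour ρ ℓ ha hb hab hNG hℓ σ)
  rw [Polynomial.Monic.nextCoeff_mul (LinearMap.charpoly_monic _) ((LinearMap.charpoly_monic _).pow 2),
    (LinearMap.charpoly_monic _).nextCoeff_pow,
    Polynomial.Monic.nextCoeff_mul ((LinearMap.charpoly_monic _).mul (LinearMap.charpoly_monic _))
      (LinearMap.charpoly_monic _),
    Polynomial.Monic.nextCoeff_mul (LinearMap.charpoly_monic _) (LinearMap.charpoly_monic _)] at h
  simp only [trace_eq_neg_nextCoeff_charpoly]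
  rw [nsmul_eq_mul, Nat.cast_ofNat] at h
  linear_combination -h

omit [PerfectField K] in
/-- **`P_X · P_{B_G}² = P_{B_a} · P_{B_b} · P_{B_{ab}}`** for Milne's characteristic polynomials of Frobenius over a finite field
(`ℓ ∤ q`) — the `ℓ`-adic shape of `ζ_X ζ_{X/G}² = ζ_{X/⟨a⟩} ζ_{X/⟨b⟩} ζ_{X/⟨ab⟩}` for the `H¹`-factors (not asserted for
the zeta functions themselves). [cite: Milne1986AbelianVarieties, §19 Thm. 19.1 and its proof (pp. 144–145)] [cite: Paulhus2008, §3 (3) (p. 234)]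
[cite: DokchitserEtAl2022, §1.3 Ex. 1.4 and §3] -/
theorem charpoly_frobenius_mul_charpoly_sq_kleinFour [Finite K] (ha : a ≠ 1) (hb : b ≠ 1) (hab : a ≠ b) {NG : X ⟶ X}
    (hNG : End.of NG = ∑ g, ρ g) (hℓ : (ℓ : K) ≠ 0) :
    haveI := X.module_free_tateModule_holds ℓ hℓ
    haveI := module_finite_tateModule_of_cast_ne_zero X ℓ hℓ
    haveI := (image NG).module_free_tateModule_holds ℓ hℓ
    haveI := module_finite_tateModule_of_cast_ne_zero (image NG) ℓ hℓ
    haveI := (image (𝟙 X + End.asHom (ρ a))).module_free_tateModule_holds ℓ hℓ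
    haveI := module_finite_tateModule_of_cast_ne_zero (image (𝟙 X + End.asHom (ρ a))) ℓ hℓ
    haveI := (image (𝟙 X + End.asHom (ρ b))).module_free_tateModule_holds ℓ hℓ
    haveI := module_finite_tateModule_of_cast_ne_zero (image (𝟙 X + End.asHom (ρ b))) ℓ hℓ
    haveI := (image (𝟙 X + End.asHom (ρ (a * b)))).module_free_tateModule_holds ℓ hℓ
    haveI := module_finite_tateModule_of_cast_ne_zero (image (𝟙 X + End.asHom (ρ (a * b)))) ℓ hℓ
    (tateModuleMap ℓ (frobeniusHom X)).charpoly * (tateModuleMap ℓ (frobeniusHom (image NG))).charpoly ^ 2 =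
      (tateModuleMap ℓ (frobeniusHom (image (𝟙 X + End.asHom (ρ a))))).charpoly *
        (tateModuleMap ℓ (frobeniusHom (image (𝟙 X + End.asHom (ρ b))))).charpoly *
          (tateModuleMap ℓ (frobeniusHom (image (𝟙 X + End.asHom (ρ (a * b)))))).charpoly := by
  haveI : PerfectField K := PerfectField.ofFinite
  haveI := X.module_free_tateModule_holds ℓ hℓ
  haveI := module_finite_tateModule_of_cast_ne_zero X ℓ hℓ
  haveI := (image NG).module_free_tateModule_holds ℓ hℓ
  haveI := module_finite_tateModule_of_cast_ne_zero (image NG) ℓ hℓ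
  haveI := (image (𝟙 X + End.asHom (ρ a))).module_free_tateModule_holds ℓ hℓ
  haveI := module_finite_tateModule_of_cast_ne_zero (image (𝟙 X + End.asHom (ρ a))) ℓ hℓ
  haveI := (image (𝟙 X + End.asHom (ρ b))).module_free_tateModule_holds ℓ hℓ
  haveI := module_finite_tateModule_of_cast_ne_zero (image (𝟙 X + End.asHom (ρ b))) ℓ hℓ
  haveI := (image (𝟙 X + End.asHom (ρ (a * b)))).module_free_tateModule_holds ℓ hℓ
  haveI := module_finite_tateModule_of_cast_ne_zero (image (𝟙 X + End.asHom (ρ (a * b)))) ℓ hℓ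
  simp only [charpoly_tateModuleMap_frobeniusHom_eq_charpoly_tateRep]
  exact charpoly_tateRep_mul_charpoly_sq_kleinFour ρ ℓ ha hb hab hNG hℓ (arithFrob K)

omit [Fact ℓ.Prime] in
/-- **`rk X(L) + 2 rk B_G(L) = rk B_a(L) + rk B_b(L) + rk B_{ab}(L)`** for the Mordell–Weil groups over any extension `L/K`
(the three `B_x(L) ⊗ ℚ` and `B_G(L) ⊗ ℚ` of finite rank; then so is `X(L) ⊗ ℚ`). [cite: Paulhus2008, §3 (3) (p. 234)]
[cite: KaniRosen1989, Thm. B] [cite: MumfordAV1970, §19 Remark p. 169] [cite: DokchitserEtAl2022, §3 (additive functor lemma)] -/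
theorem finrank_points_add_two_mul_kleinFour (ha : a ≠ 1) (hb : b ≠ 1) (hab : a ≠ b) {NG : X ⟶ X}
    (hNG : End.of NG = ∑ g, ρ g) (L : Type u) [Field L] [Algebra K L]
    [Module.Finite ℚ (ℚ ⊗[ℤ] Additive ((image NG).Points L))]
    [Module.Finite ℚ (ℚ ⊗[ℤ] Additive ((image (𝟙 X + End.asHom (ρ a))).Points L))]
    [Module.Finite ℚ (ℚ ⊗[ℤ] Additive ((image (𝟙 X + End.asHom (ρ b))).Points L))]
    [Module.Finite ℚ (ℚ ⊗[ℤ] Additive ((image (𝟙 X + End.asHom (ρ (a * b)))).Points L))] :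
    Module.finrank ℚ (ℚ ⊗[ℤ] Additive (X.Points L)) + 2 * Module.finrank ℚ (ℚ ⊗[ℤ] Additive ((image NG).Points L)) =
      Module.finrank ℚ (ℚ ⊗[ℤ] Additive ((image (𝟙 X + End.asHom (ρ a))).Points L)) +
        Module.finrank ℚ (ℚ ⊗[ℤ] Additive ((image (𝟙 X + End.asHom (ρ b))).Points L)) +
          Module.finrank ℚ (ℚ ⊗[ℤ] Additive ((image (𝟙 X + End.asHom (ρ (a * b)))).Points L)) := by
  have hiso := isIsogenous_kleinFour_halved ρ ha hb hab hNG
  haveI := module_finite_points_biprod (image NG) (image NG) L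
  haveI := module_finite_points_biprod (image (𝟙 X + End.asHom (ρ b))) (image (𝟙 X + End.asHom (ρ (a * b)))) L
  haveI := module_finite_points_biprod (image (𝟙 X + End.asHom (ρ a)))
    (image (𝟙 X + End.asHom (ρ b)) ⊞ image (𝟙 X + End.asHom (ρ (a * b)))) L
  haveI : Module.Finite ℚ (ℚ ⊗[ℤ] Additive ((X ⊞ (image NG ⊞ image NG)).Points L)) :=
    (hiso.module_finite_points_iff L).2 inferInstance
  -- `X(L) ⊗ ℚ` is a direct factor of a finite-dimensional space
  obtain ⟨e⟩ := nonempty_linearEquiv_points_biprod X (image NG ⊞ image NG) L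
  haveI : Module.Finite ℚ (ℚ ⊗[ℤ] Additive (X.Points L)) := by
    refine Module.Finite.of_surjective
      ((LinearMap.fst ℚ (ℚ ⊗[ℤ] Additive (X.Points L)) (ℚ ⊗[ℤ] Additive ((image NG ⊞ image NG).Points L))) ∘ₗ
        e.toLinearMap) fun x ↦ ⟨e.symm (x, 0), ?_⟩
    simp
  have h := hiso.finrank_points_eq L
  rw [finrank_points_biprod, finrank_points_biprod, finrank_points_biprod, finrank_points_biprod] at h
  omega

end AbelianVariety

end Literature.AlgebraicGeometry.Motives
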